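/-
Copyright (c) 2026 the pub-hodgecm-mathlib formalisation cell (harness21).  Prover seat hodgecm-mathlib-K2E1-p09 (g5), Track B ∕ K2-LIT,
h413 = `stmt-HodgeConjecture-24833`, line `K2_E1_TraceFormulaBeta`, page «EIS-RANK-ONE», deal [D1] «EIS-R6d₂-residuals → R6e-inputs (N = 2)» of the
dealer K2E1-plan (g3) 2026-09-04T05:34:55Z, part (D1-a): the NORMALISATION `hnorm` of ★ R6d₂ (a) `K2E1EisensteinMinusConstantTermPoissonU2` discharged for
every Haar measure of `N(𝔸_F)`, every fundamental domain of `N(F)`, every additive Haar measure of `𝔸_F`.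
-/
import Literature.NumberTheory.Automorphic.UnitaryGroupLineHaarNormalisationTwo   -- ★ the engine: `inv_mul_integral_eq_inv_mul_integral_traceZeroLine_two`
import Literature.NumberTheory.Automorphic.UnitaryGroupTraceZeroLine             -- ★ `traceZeroLine : 𝔸_F ≃ₜ+ 𝔸_E⁻`
import Literature.NumberTheory.Automorphic.U3LocalBruhatDecompositionProofs     -- ★ `weylLongU` (the long Weyl element `w₀` of `U(J_N)(F)`)
import HarnessLib

/-!
# h413 ∕ Track B «K2-LIT», «EIS-RANK-ONE» R6d₂ residual (D1-a) — `K2E1UnipotentHaarNormalisationU2`: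
# `(ν 𝓕)⁻¹ · ∫_{N(𝔸_F)} T dν = μ(D_F)⁻¹ · ∫_{𝔸_F} T(n(θ x)) dμ(x)` on `U(J₂)` — the `hnorm` letter of ★ R6d₂ (a), unconditionally

Cell `pub/hodgecm-mathlib`, crux H413 = `stmt-HodgeConjecture-24833`, route `HCCMUnconditional`; dealer K2E1-plan (g3), deal [D1] 05:34:55Z; REPORT-FIRST
05:4xZ.  THEOREMS ONLY (no `def`, no `instance`, no `notation`, no named-fact hypothesis, no `sorry`); lane `--kind proof --supports
stmt-HodgeConjecture-24833 --as helper` (count-neutral).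

THE POINT.  ★ R6d₂ (a) `eisensteinSeriesU_sub_borelConstantTerm_eq_two` (and everything downstream: ★ (b) `…BoundU2`, ★ (b-i) `…BigCellLineDilationU2`,
★ the cusp bound `forall_norm_sub_borelConstantTerm_le_two`) carries ONE bookkeeping hypothesis `hnorm`: the big-cell integral of the constant term, normalised
by the mass of a fundamental domain `𝓕` of `N(F)∖N(𝔸_F)` for the unipotent Haar measure `ν`, equals Tate's normalised integral along the line chart
`x ↦ n(θ x)` (`θ = traceZeroLine : 𝔸_F ≃ 𝔸_E⁻`, `n = middleRootUnipotent : 𝔸_E⁻ ≅ N(𝔸_F)`):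
`(ν 𝓕)⁻¹ • ∫_{N(𝔸_F)} f(w₀ v g) dν(v) = μ(D_F)⁻¹ · ∫_{𝔸_F} f(w₀ n(θ x) g) dμ(x)`.
The identity holds for EVERY Haar measure `ν` of `N(𝔸_F)`, EVERY `ν`-fundamental domain `𝓕` of `N(F)`, EVERY additive Haar measure `μ` of `𝔸_F` and EVERY
integrand (no measurability needed): both sides are scale-free, `ν = r • (n ∘ θ)_* μ` by Haar uniqueness on the second countable locally compact group
`N(𝔸_F)`, and `ν(𝓕) = ν(n(θ D_F)) = r · μ(D_F)` because two fundamental domains of the countable group `N(F)` have the same mass.  All of this is ★ in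
`Literature/NumberTheory/Automorphic/UnitaryGroupLineHaarNormalisationTwo` (the H-side (ET-ν)_two letter, `inv_mul_integral_eq_inv_mul_integral_traceZeroLine_two`);
this file is its READING in the byte shape the R6d₂ chain consumes, plus the two instance letters the assembly (D1-d) needs to feed ★ (a)'s
`[ν.IsMulLeftInvariant] [ν.IsInvInvariant]` and `h𝓕 ∕ h𝓕₀ ∕ h𝓕top` from a bare Haar measure.

* §1 `inv_measure_smul_integral_eq_traceZeroLine_two` — the scale-free identity for any `T : N(𝔸_F) → ℂ`, in the `•` ∕ `(… : ℂ)⁻¹ *` spelling of ★ (a).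
* §2 **`forall_inv_measure_smul_integral_weylLong_eq_two`** — ★ `forall_norm_sub_borelConstantTerm_le_two`'s hypothesis `hnorm` TOKEN FOR TOKEN (`∀ g`), and the
  single-`g` form `inv_measure_smul_integral_weylLong_eq_two` (= the `hnorm` of ★ (a), (b)).
* §3 `isInvInvariant_of_isHaarMeasure_two` — a Haar measure of the ABELIAN group `N(𝔸_F) ≅ 𝔸_E⁻` (★ `mul_comm_adelicUnipotent_two`) is inversion invariant
  (Mathlib `IsHaarMeasure.isInvInvariant_of_regular`, regularity from second countability); `exists_isFundamentalDomain_two` — a `ν`-fundamental domain of `N(F)`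
  of mass `∉ {0, ∞}` exists for every Haar `ν` (★ `isFundamentalDomain_image_traceZeroFundamentalDomain_two`, ★ `measure_fundamentalDomain_ne_zero_and_lt_top_two`).

HONEST LABEL.  Count-neutral helper; proves no printed statement; HC_CM is proved only modulo the 7 printed citations (2 remaining named inputs: hLiu418 =
`stmt-HodgeConjecture-24832`, h413 = `stmt-HodgeConjecture-24833`) until rung 0 closes.

## References
* [Rogawski1990] J. D. Rogawski, *Automorphic Representations of Unitary Groups in Three Variables*, Ann. of Math. Stud. 123 (1990), §1.10, Prop. 7.3.1 (p. 98).
* [CasselsFrohlichANT1967] J. W. S. Cassels, A. Fröhlich (eds.), *Algebraic Number Theory* (1967), Ch. XV (Tate) Thm. 4.1.3.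
* [MoeglinWaldspurger1995] C. Mœglin, J.-L. Waldspurger, *Spectral decomposition and Eisenstein series* (1995), I.2.6, II.1.7 (the normalisation of `dn`).
-/

set_option autoImplicit false
set_option linter.dupNamespace false  -- the mandated namespace repeats the summit's segment (`HodgeConjecture.HodgeConjecture`)

noncomputable section

open MeasureTheory Measure NumberField IsDedekindDomain
open Literature.NumberTheory.Automorphic Literature.NumberTheory.Automorphic.UnitaryGroup
open scoped ENNReal NNReal

namespace Summit.HodgeConjecture.HodgeConjecture.Cruxes.H413.K2E1UnipotentHaarNormalisationU2

variable {F E : Type} [Field F] [NumberField F] [Field E] [NumberField E] [Algebra F E] [Algebra.IsQuadraticExtension F E] {c : E ≃ₐ[F] E}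
  (hij : (((0 : Fin 2) : ℕ)) + 1 = ((1 : Fin 2) : ℕ)) (hN : 2 = 2 * ((0 : Fin 2) : ℕ) + 2) {δ : E} (hcδ : c δ = -δ) (hδ : δ ≠ 0)
  [LocallyCompactSpace (AdeleRing (𝓞 E) E)]
  [MeasurableSpace (AdeleRing (𝓞 E) E)] [BorelSpace (AdeleRing (𝓞 E) E)]
  [MeasurableSpace (AdeleRing (𝓞 F) F)] [BorelSpace (AdeleRing (𝓞 F) F)]
  [MeasurableSpace ↥(adelicUnipotent F E c 2)] [BorelSpace ↥(adelicUnipotent F E c 2)]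

/-! ## §1 The scale-free identity along the line chart -/

/-- **`(ν 𝓕)⁻¹ • ∫_{N(𝔸_F)} T dν = μ(D_F)⁻¹ · ∫_{𝔸_F} T(n(θ x)) dμ(x)`** for every Haar measure `ν` of `N(𝔸_F) ≤ U(J₂)(𝔸_F)`, every `ν`-fundamental domain `𝓕`
of `N(F)`, every additive Haar measure `μ` of `𝔸_F` and every `T : N(𝔸_F) → ℂ` (★ `inv_mul_integral_eq_inv_mul_integral_traceZeroLine_two`, read with a real
scalar action on the left and a complex inverse on the right). [cite: Rogawski1990, Prop. 7.3.1 (p. 98)] [cite: CasselsFrohlichANT1967, Ch. XV Thm. 4.1.3 (2)] -/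
theorem inv_measure_smul_integral_eq_traceZeroLine_two (hc : c * c = 1)
    (μ : Measure (AdeleRing (𝓞 F) F)) [μ.IsAddHaarMeasure]
    (ν : Measure ↥(adelicUnipotent F E c 2)) [ν.IsHaarMeasure]
    {𝓕 : Set ↥(adelicUnipotent F E c 2)} (h𝓕 : IsFundamentalDomain ↥(rationalUnipotent F E c 2) 𝓕 ν)
    (T : ↥(adelicUnipotent F E c 2) → ℂ) :
    ((ν 𝓕).toReal⁻¹ : ℝ) • ∫ v, T v ∂ν =
      ((μ (adeleFundamentalDomain F)).toReal⁻¹ : ℂ) *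
        ∫ x, T (middleRootUnipotent hij hN (Multiplicative.ofAdd (traceZeroLine F E c hcδ hδ x))) ∂μ := by
  rw [Complex.real_smul, inv_mul_integral_eq_inv_mul_integral_traceZeroLine_two hij hN hcδ hδ hc μ ν h𝓕 T, Complex.ofReal_inv]

/-! ## §2 The `hnorm` letter of the R6d₂ chain -/

/-- **THE `hnorm` LETTER AT ONE `g`** (★ R6d₂ (a) `eisensteinSeriesU_sub_borelConstantTerm_eq_two`, ★ (b) `norm_sub_borelConstantTerm_le_const_two`): for every
`f : U(J₂)(𝔸_F) → ℂ` and every `g`,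
`(ν 𝓕)⁻¹ • ∫_{N(𝔸_F)} f(ι(w₀) · v · g) dν(v) = μ(D_F)⁻¹ · ∫_{𝔸_F} f(ι(w₀) · n(θ x) · g) dμ(x)`. [cite: MoeglinWaldspurger1995, II.1.7]
[cite: Rogawski1990, Prop. 7.3.1 (p. 98)] -/
theorem inv_measure_smul_integral_weylLong_eq_two (hc : c * c = 1)
    (μ : Measure (AdeleRing (𝓞 F) F)) [μ.IsAddHaarMeasure]
    (ν : Measure ↥(adelicUnipotent F E c 2)) [ν.IsHaarMeasure]
    {𝓕 : Set ↥(adelicUnipotent F E c 2)} (h𝓕 : IsFundamentalDomain ↥(rationalUnipotent F E c 2) 𝓕 ν)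
    (f : (quasiSplit F E c 2).Adelic → ℂ) (g : (quasiSplit F E c 2).Adelic) :
    ((ν 𝓕).toReal⁻¹ : ℝ) • ∫ v : ↥(adelicUnipotent F E c 2),
        f (((quasiSplit F E c 2).toAdelic (weylLongU (c : E →+* E) (rfl : ((StdForm.antidiagonal 2).over E) = ((StdForm.antidiagonal 2).over E)))) *
          (v : (quasiSplit F E c 2).Adelic) * g) ∂ν =
      ((μ (adeleFundamentalDomain F)).toReal⁻¹ : ℂ) *
        ∫ x, (fun x : AdeleRing (𝓞 F) F =>
          f (((quasiSplit F E c 2).toAdelic (weylLongU (c : E →+* E) (rfl : ((StdForm.antidiagonal 2).over E) = ((StdForm.antidiagonal 2).over E)))) *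
            ((middleRootUnipotent hij hN (Multiplicative.ofAdd (traceZeroLine F E c hcδ hδ x)) : ↥(adelicUnipotent F E c 2)) :
              (quasiSplit F E c 2).Adelic) * g)) x ∂μ :=
  inv_measure_smul_integral_eq_traceZeroLine_two hij hN hcδ hδ hc μ ν h𝓕 _

/-- **THE `hnorm` LETTER, `∀ g` FORM** — ★ `K2E1EisensteinMinusConstantTermCuspBoundU2.forall_norm_sub_borelConstantTerm_le_two`'s hypothesis `hnorm` token for token,
for every Haar measure `ν` of `N(𝔸_F)`, every `ν`-fundamental domain `𝓕` of `N(F)`, every additive Haar measure `μ` of `𝔸_F`, every `f`.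
[cite: MoeglinWaldspurger1995, II.1.7] [cite: Rogawski1990, Prop. 7.3.1 (p. 98)] -/
theorem forall_inv_measure_smul_integral_weylLong_eq_two (hc : c * c = 1)
    (μ : Measure (AdeleRing (𝓞 F) F)) [μ.IsAddHaarMeasure]
    (ν : Measure ↥(adelicUnipotent F E c 2)) [ν.IsHaarMeasure]
    {𝓕 : Set ↥(adelicUnipotent F E c 2)} (h𝓕 : IsFundamentalDomain ↥(rationalUnipotent F E c 2) 𝓕 ν)
    (f : (quasiSplit F E c 2).Adelic → ℂ) :
    ∀ g : (quasiSplit F E c 2).Adelic,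
      ((ν 𝓕).toReal⁻¹ : ℝ) • ∫ v : ↥(adelicUnipotent F E c 2),
          f (((quasiSplit F E c 2).toAdelic (weylLongU (c : E →+* E) (rfl : ((StdForm.antidiagonal 2).over E) = ((StdForm.antidiagonal 2).over E)))) *
            (v : (quasiSplit F E c 2).Adelic) * g) ∂ν =
        ((μ (adeleFundamentalDomain F)).toReal⁻¹ : ℂ) *
          ∫ x, (fun x : AdeleRing (𝓞 F) F =>
            f (((quasiSplit F E c 2).toAdelic (weylLongU (c : E →+* E) (rfl : ((StdForm.antidiagonal 2).over E) = ((StdForm.antidiagonal 2).over E)))) *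
              ((middleRootUnipotent hij hN (Multiplicative.ofAdd (traceZeroLine F E c hcδ hδ x)) : ↥(adelicUnipotent F E c 2)) :
                (quasiSplit F E c 2).Adelic) * g)) x ∂μ :=
  fun g => inv_measure_smul_integral_weylLong_eq_two hij hN hcδ hδ hc μ ν h𝓕 f g

/-! ## §3 Instance letters for the assembly: inversion invariance, a fundamental domain of finite positive mass -/

omit [Algebra.IsQuadraticExtension F E] [MeasurableSpace (AdeleRing (𝓞 E) E)] [BorelSpace (AdeleRing (𝓞 E) E)]
  [MeasurableSpace (AdeleRing (𝓞 F) F)] [BorelSpace (AdeleRing (𝓞 F) F)] in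
/-- **A Haar measure of `N(𝔸_F) ≤ U(J₂)(𝔸_F)` is inversion invariant**: the group is abelian (`N(𝔸_F) ≅ 𝔸_E⁻`, ★ `mul_comm_adelicUnipotent_two`) and second countable
locally compact, so every Haar measure is regular and Mathlib's `IsHaarMeasure.isInvInvariant_of_regular` applies (this feeds ★ R6d₂ (a)'s `[ν.IsInvInvariant]`).
[cite: Rogawski1990, §1.10] -/
theorem isInvInvariant_of_isHaarMeasure_two (ν : Measure ↥(adelicUnipotent F E c 2)) [ν.IsHaarMeasure] : ν.IsInvInvariant := by
  haveI := locallyCompactSpace_adelicUnipotent_two (F := F) (E := E) (c := c)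
  haveI := secondCountableTopology_adeleRing E
  haveI : SecondCountableTopology (quasiSplit F E c 2).Adelic :=
    inferInstanceAs (SecondCountableTopology (adelic F E c 2 ((StdForm.antidiagonal 2).over E)))
  haveI : SecondCountableTopology ↥(adelicUnipotent F E c 2) := TopologicalSpace.Subtype.secondCountableTopology _
  -- Haar measures on the second countable locally compact group `N(𝔸_F)` are regular
  haveI : ν.Regular := inferInstance
  -- `N(𝔸_F) ≅ 𝔸_E⁻` is abelian
  letI : CommGroup ↥(adelicUnipotent F E c 2) := { toGroup := inferInstance, mul_comm := mul_comm_adelicUnipotent_two }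
  exact IsHaarMeasure.isInvInvariant_of_regular ν

omit [Algebra.IsQuadraticExtension F E] [MeasurableSpace (AdeleRing (𝓞 F) F)] [BorelSpace (AdeleRing (𝓞 F) F)] in
include hij hN in
/-- **A measurable fundamental domain of `N(F)∖N(𝔸_F)` of finite positive mass exists for every Haar measure `ν`** — the transported Tate domain `n(𝓕⁻)`
(★ `isFundamentalDomain_image_traceZeroFundamentalDomain_two`, ★ `measurableSet_image_traceZeroFundamentalDomain_two`, and ★
`measure_fundamentalDomain_ne_zero_and_lt_top_two` read off an additive Haar measure of the locally compact group `𝔸_E⁻`, ★ `locallyCompactSpace_traceZeroAdele`);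
feeds ★ R6d₂ (a)'s `h𝓕 ∕ h𝓕₀ ∕ h𝓕top`. [cite: CasselsFrohlichANT1967, Ch. XV Thm. 4.1.3] -/
theorem exists_isFundamentalDomain_two (hc : c * c = 1) (ν : Measure ↥(adelicUnipotent F E c 2)) [ν.IsHaarMeasure] :
    ∃ 𝓕 : Set ↥(adelicUnipotent F E c 2),
      IsFundamentalDomain ↥(rationalUnipotent F E c 2) 𝓕 ν ∧ MeasurableSet 𝓕 ∧ ν 𝓕 ≠ 0 ∧ ν 𝓕 ≠ ⊤ := by
  haveI := locallyCompactSpace_traceZeroAdele (F := F) (E := E) (c := c)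
  have h𝓕 := isFundamentalDomain_image_traceZeroFundamentalDomain_two (F := F) (E := E) (c := c) hij hN hc ν
  obtain ⟨h0, ht⟩ := measure_fundamentalDomain_ne_zero_and_lt_top_two hij hN hc
    (Measure.addHaar : Measure ↥(traceZeroAdele F E c)) ν h𝓕
  exact ⟨_, h𝓕, measurableSet_image_traceZeroFundamentalDomain_two hij hN, h0, ht.ne⟩

end Summit.HodgeConjecture.HodgeConjecture.Cruxes.H413.K2E1UnipotentHaarNormalisationU2

end
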